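import Summits.CriticalPhenomena.PercolationContinuityZ3.Theorems.PercNearOneGluingNoHeavyQuantFarSunCertEightTwo
import Summits.CriticalPhenomena.PercolationContinuityZ3.Theorems.PercNearOneGluingNoHeavyQuantFarSunCertEightThreeB
import Summits.CriticalPhenomena.PercolationContinuityZ3.Theorems.PercNearOneGluingNoHeavyQuantFarSunRowLeSeven
import Summits.CriticalPhenomena.PercolationContinuityZ3.Theorems.PercNearOneGluingNoHeavyQuantFarSunTKFinalAllK
import Summits.CriticalPhenomena.PercolationContinuityZ3.Theorems.PercNearOneGluingNoHeavyQuantFarSunRow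
import HarnessLib

/-!
# FAR beyond trees: **`HairyCycle.SunFAR K j` for every `K ≤ 8` and every layer `j`**

builds on p205010 (kernel theorem, internal audit signed; external expert review pending)

Support file (`--supports stmt-CriticalPhenomena-4575`), seat `prim-cert-1` (gen 26); memo `prim-cert-1/FROM-prim-cert-1-g26-CONFIG-CERTS.md`.
Assembly of the `K = 8` layers: layer `0` is the union bound (`TwoCopy.FARp.zero`), layer `1` is gen 23's `sunFAR_one` (all `K`), layers `2` and
`3` are the Kronecker-checked law-level certificates `sunFAR_eight_two` (`…QuantFarSunCertEightTwo`, typed configuration level) and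
`sunFAR_eight_three` (`…QuantFarSunCertEightThreeB`, reached-set level), layers `j ≥ 4` are vacuous (`2j ≥ 8` relays, `TwoCopy.FARp.of_card_le`).
* `HairyCycle.sunFAR_eight` — `SunFAR 8 j` for every `j`;
* **`HairyCycle.sunFAR_of_le_eight`** — `SunFAR K j` for `2 ≤ K ≤ 8`, every `j` (extends gen 18's `sunFAR_of_le_seven`);
* `HairyCycle.farRelayRow_hairyCycle_of_le_eight` — hence `Quant.FarRelayRow`'s body at every layer on every hairy cycle with `K ≤ 8` pendant relays.
No sorries; the computational content (`native_decide`) lives in the certificate files.  [this work]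
-/

namespace Summit.CriticalPhenomena.PercolationContinuityZ3.Theorems.HairyCycle

open Finset MeasureTheory
open Literature.Probability.Percolation Literature.Probability.LatticeModels
open Summit.CriticalPhenomena.PercolationContinuityZ3.Theorems.TwoCopy
open scoped Classical

/-- **`SunFAR 8 j` for every layer `j`.** [this work] -/
theorem sunFAR_eight (j : ℕ) : SunFAR 8 j := by
  rcases Nat.lt_or_ge j 4 with hj | hj
  · interval_cases j
    · exact sunFAR_of_farp_sun (by norm_num) fun q _ => FARp.zero q _ _
    · exact sunFAR_one (by norm_num)
    · exact sunFAR_eight_two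
    · exact sunFAR_eight_three
  · exact sunFAR_of_farp_sun (by norm_num) fun q _ =>
      FARp.of_card_le q _ _ j (Finset.card_image_le.trans (by rw [Finset.card_range]; omega))

/-- **`SunFAR K j` for `2 ≤ K ≤ 8` and every layer `j`.** [this work] -/
theorem sunFAR_of_le_eight {K : ℕ} (hK2 : 2 ≤ K) (hK8 : K ≤ 8) (j : ℕ) : SunFAR K j := by
  rcases Nat.lt_or_ge K 8 with h | h
  · exact sunFAR_of_le_seven hK2 (by omega) j
  · obtain rfl : K = 8 := le_antisymm hK8 h
    exact sunFAR_eight j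

/-- **FAR (`Quant.FarRelayRow`'s body) at every layer on every hairy cycle with `K ≤ 8` pendant relays**, all weights. [this work] -/
theorem farRelayRow_hairyCycle_of_le_eight {n L K : ℕ} {cyc : ℕ → Fin n} {base : ℕ → ℕ} {tip : ℕ → Fin n} (H : IsHairyCycle L cyc K base tip)
    (hK2 : 2 ≤ K) (hK8 : K ≤ 8) (w : Sym2 (Fin n) → unitInterval)
    (hsupp : ∀ e : Sym2 (Fin n), ¬ e.IsDiag → w e ≠ 0 →
      (∃ i, i < L ∧ e = cycE L cyc i) ∨ (∃ k, k < K ∧ e = hairE cyc base tip k))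
    (j : ℕ) (t : ℝ)
    (hEN : (2 * j : ℝ) < ∑ a ∈ (Finset.range K).image tip, (prodBernoulli w).real (openConn (cyc 0) a))
    (hcut : ∀ a ∈ (Finset.range K).image tip, (prodBernoulli w).real (openConn (cyc 0) a)ᶜ ≤ t) :
    (prodBernoulli w).real {ω : BondConfig (Fin n) |
      (((Finset.range K).image tip).filter fun a => ω ∈ openConn (cyc 0) a).card ≤ j} ≤ t :=
  farRelayRow_hairyCycle_of_forall_sunFAR H (sunFAR_of_le_eight hK2 hK8) w hsupp j t hEN hcut

end Summit.CriticalPhenomena.PercolationContinuityZ3.Theorems.HairyCycle
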